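import Literature.AlgebraicGeometry.HodgeTheory.QuaternionicQuarticFermatMemberCharts
import Literature.AlgebraicGeometry.HodgeTheory.QuaternionicQuarticFermatMemberChartOne
import HarnessLib

/-!
# The Fermat member: its branch curve is NODAL in the charts `U₂, U₃, U₄` of `𝔽₂` (all four charts done)

Layer `Literature/AlgebraicGeometry/HodgeTheory`, namespace `Literature.AlgebraicGeometry.HodgeTheory.Q8Family`. Theorems only (no
definition, no named fact). Written by the prover seat `leafhand-hodge-q8symplecticpowers-4` (g5, cell `pub-hsemireg`), part (T2b) of
target (T2) «one explicit nodal member for every even `e`» of memo NINTH-HAND-S1-DESIGN-leafhand4-g5 (route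
`HodgeConjecture/Q8SymplecticPowers`, crux K1Q, stmt-HodgeConjecture-24190, stub S1; consumer: the hypothesis `hNod` of
`Q8SymplecticPowersRegularOfNodalBranchCurve.stub_regularVeryGeneralQ_of_nodalDoubleCoverFact` at `a = fermatParam e`, `α = e`, `N = 1`).

By `…FermatMemberCharts`, the chart-`U₃` branch curve is `(s³ − s)·Φ₃`, `Φ₃ = (s² − 2v)^d + (1 − 2v)^d + v^d` (`d = e − 1` odd, `≥ 3`),
and the chart-`U₂` ∕ `U₄` curves are `−G₂` ∕ `−(s³ − s)Φ₃` in their own coordinates. Here: `Φ₃ = 0` is smooth and transversal to the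
lines `s ∈ {0, ±1}` — at a common zero of `Φ₃` and `∂_vΦ₃` with `A := s² − 2v`, `w := 1 − 2v`: if `s = 0` then `A + 2v = 0`, `w + 2v = 1`
and `Φ₃ − v·∂_vΦ₃/d = wⁿ` (`n = d − 1`) forces `w = 0`, `v = ½`, and then `∂_vΦ₃ = 0` reads `(½)ⁿ = 2`; if `s² = 1` then `A = w` and
`½Φ₃ − ½v·∂_vΦ₃/d = wⁿ` forces `w = 0`, then `vⁿ = 0`, contradiction; if `A = 0` (from `∂_sΦ₃ = 2d·s·Aⁿ = 0`) then `Φ₃ − v∂_vΦ₃/d = wⁿ`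
again. Assembled with `IsNodal.mul` and `IsNodal.C_mul`: **the branch curve of the Fermat member is nodal in all four charts of `𝔽₂`**
(`isNodal_fermatParam_allCharts`), together with the support bounds (first clause of `IsChartExact e 1 G₂`). What remains of `hNod` at
this member: the two exactness witnesses of `IsChartExact` (a monomial `s^{2e+1}y^{e}` of `G₂`) — T2c. Honest scope: explicit calculus;
nothing here bears on HC; S1 ∕ K1Q NOT proved here.

References: [Fulton2008] §3.1 (nodes); [Hartshorne1977] V.2; [Zariski1929]; [Naie2007] §1.2.
-/

noncomputable section

open MvPolynomial
open Literature.AlgebraicGeometry.PlaneCurves.SingularPointsEnvelopes Literature.AlgebraicGeometry.PlaneCurves.AffineNodalCurves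
open Literature.AlgebraicGeometry.Surfaces.HirzebruchTwoDoublePlane

namespace Literature.AlgebraicGeometry.HodgeTheory.Q8Family

/-! ### Arithmetic -/

/-- `2^(n+1) ≠ 1` in `ℂ`. [folklore] -/
private theorem two_pow_succ_ne_one (n : ℕ) : (2 : ℂ) ^ (n + 1) ≠ 1 := by
  intro h
  have h2 : ((2 ^ (n + 1) : ℕ) : ℂ) = ((1 : ℕ) : ℂ) := by push_cast; exact h
  have h3 : 2 ^ (n + 1) = 1 := by exact_mod_cast h2
  have h4 : 2 ≤ 2 ^ (n + 1) := by
    calc 2 = 2 ^ 1 := by norm_num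
      _ ≤ 2 ^ (n + 1) := Nat.pow_le_pow_right (by norm_num) (by omega)
  omega

/-! ### The chart-`U₃` curve `Φ₃` -/

/-- `Φ₃(p)`. [folklore] -/
private theorem eval_Φ₃ (e : ℕ) (p : Fin 2 → ℂ) :
    MvPolynomial.eval p ((X 0 ^ 2 - C 2 * X 1) ^ (e - 1) + (1 - C 2 * X 1) ^ (e - 1) + X 1 ^ (e - 1) : MvPolynomial (Fin 2) ℂ) =
      (p 0 ^ 2 - 2 * p 1) ^ (e - 1) + (1 - 2 * p 1) ^ (e - 1) + p 1 ^ (e - 1) := by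
  simp

/-- `∂_sΦ₃(p) = d·(s² − 2v)^{d−1}·2s`. [cite: Fulton2008, §3.1 (tangent lines)] -/
theorem grad_Φ₃_zero (e : ℕ) (p : Fin 2 → ℂ) :
    grad ((X 0 ^ 2 - C 2 * X 1) ^ (e - 1) + (1 - C 2 * X 1) ^ (e - 1) + X 1 ^ (e - 1) : MvPolynomial (Fin 2) ℂ) p 0 =
      (e - 1 : ℕ) * (p 0 ^ 2 - 2 * p 1) ^ (e - 1 - 1) * (2 * p 0) := by
  rw [grad_apply]
  simp [pderiv_X]
  ring

/-- `∂_vΦ₃(p) = −2d·(s² − 2v)^{d−1} − 2d·(1 − 2v)^{d−1} + d·v^{d−1}`. [cite: Fulton2008, §3.1 (tangent lines)] -/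
theorem grad_Φ₃_one (e : ℕ) (p : Fin 2 → ℂ) :
    grad ((X 0 ^ 2 - C 2 * X 1) ^ (e - 1) + (1 - C 2 * X 1) ^ (e - 1) + X 1 ^ (e - 1) : MvPolynomial (Fin 2) ℂ) p 1 =
      (e - 1 : ℕ) * (p 0 ^ 2 - 2 * p 1) ^ (e - 1 - 1) * (-2) + (e - 1 : ℕ) * (1 - 2 * p 1) ^ (e - 1 - 1) * (-2) +
        (e - 1 : ℕ) * p 1 ^ (e - 1 - 1) := by
  rw [grad_apply]
  simp [pderiv_X]
  ring

/-- **`∂_vΦ₃ ≠ 0` at the points of `Φ₃ = 0` on the lines `s³ = s`** (transversality to `f₀, f₁, f₋₁` in chart `U₃`), `d = e − 1` odd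
and `≥ 3`. [cite: Fulton2008, §3.1 (ordinary multiple points)] -/
theorem grad_Φ₃_one_ne_zero {e : ℕ} (he : Odd (e - 1)) (h3 : 3 ≤ e - 1) (p : Fin 2 → ℂ) (hs : p 0 * (p 0 - 1) * (p 0 + 1) = 0)
    (hΦ : MvPolynomial.eval p
      ((X 0 ^ 2 - C 2 * X 1) ^ (e - 1) + (1 - C 2 * X 1) ^ (e - 1) + X 1 ^ (e - 1) : MvPolynomial (Fin 2) ℂ) = 0) :
    grad ((X 0 ^ 2 - C 2 * X 1) ^ (e - 1) + (1 - C 2 * X 1) ^ (e - 1) + X 1 ^ (e - 1) : MvPolynomial (Fin 2) ℂ) p 1 ≠ 0 := by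
  obtain ⟨n, hn⟩ : ∃ n, e - 1 = n + 1 := ⟨e - 2, by omega⟩
  have hn' : e - 1 - 1 = n := by omega
  have hne : Even n := by
    have : n = (e - 1) - 1 := by omega
    rw [this]; exact Nat.Odd.sub_odd he odd_one
  have hd : ((e - 1 : ℕ) : ℂ) ≠ 0 := by exact_mod_cast (show e - 1 ≠ 0 by omega)
  rw [eval_Φ₃, hn] at hΦ
  rw [grad_Φ₃_one, hn']
  intro h
  set v := p 1 with hv
  have h2 : (p 0 ^ 2 - 2 * v) ^ n * (-2) + (1 - 2 * v) ^ n * (-2) + v ^ n = 0 := by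
    have : ((e - 1 : ℕ) : ℂ) * ((p 0 ^ 2 - 2 * v) ^ n * (-2) + (1 - 2 * v) ^ n * (-2) + v ^ n) = 0 := by
      linear_combination h
    exact (mul_eq_zero.1 this).resolve_left hd
  rcases mul_eq_zero.1 hs with h' | h'
  · rcases mul_eq_zero.1 h' with h0 | h1
    · -- `s = 0`: `A = -2v`
      rw [h0] at hΦ h2
      have hw : (1 - 2 * v) ^ n = 0 := by linear_combination hΦ - v * h2
      have hw' : 1 - 2 * v = 0 := pow_eq_zero_iff (by omega) |>.1 hw |> fun h => by
        rcases Nat.eq_zero_or_pos n with hn0 | hn0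
        · rw [hn0, pow_zero] at hw; exact absurd hw one_ne_zero
        · exact (pow_eq_zero_iff hn0.ne').1 hw
      have hv2 : v = 1 / 2 := by linear_combination -hw' / 2
      rw [hv2] at h2
      have h4 : ((0 : ℂ) ^ 2 - 2 * (1 / 2)) ^ n = 1 := by
        rw [show ((0 : ℂ) ^ 2 - 2 * (1 / 2)) = -1 by ring, hne.neg_one_pow]
      rw [h4, show ((1 : ℂ) - 2 * (1 / 2)) = 0 by ring, zero_pow (by
        rintro rfl; rw [pow_zero] at hw; exact one_ne_zero hw), zero_mul, add_zero] at h2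
      -- `h2 : 1 * (-2) + (1/2)^n = 0`
      have h5 : (2 : ℂ) ^ n * (1 / 2) ^ n = 1 := by rw [← mul_pow]; norm_num
      have h6 : (2 : ℂ) ^ (n + 1) = 1 := by
        rw [pow_succ]
        linear_combination (-(2 : ℂ) ^ n) * h2 + h5
      exact two_pow_succ_ne_one n h6
    · -- `s = 1`: `A = w`
      have h1' : p 0 = 1 := by linear_combination h1
      rw [h1'] at hΦ h2
      have hw : (1 - 2 * v) ^ n = 0 := by linear_combination (1 / 2 : ℂ) * hΦ - (v / 2) * h2
      rcases Nat.eq_zero_or_pos n with hn0 | hn0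
      · rw [hn0, pow_zero] at hw; exact one_ne_zero hw
      have hw' : 1 - 2 * v = 0 := (pow_eq_zero_iff hn0.ne').1 hw
      rw [show ((1 : ℂ) ^ 2 - 2 * v) = 1 - 2 * v by ring, hw', zero_pow hn0.ne', zero_mul, zero_add, zero_add] at h2
      have : v = 0 := (pow_eq_zero_iff hn0.ne').1 h2
      rw [this] at hw'
      norm_num at hw'
  · -- `s = -1`: `A = w`
    have h1' : p 0 = -1 := by linear_combination h'
    rw [h1'] at hΦ h2
    have hw : (1 - 2 * v) ^ n = 0 := by linear_combination (1 / 2 : ℂ) * hΦ - (v / 2) * h2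
    rcases Nat.eq_zero_or_pos n with hn0 | hn0
    · rw [hn0, pow_zero] at hw; exact one_ne_zero hw
    have hw' : 1 - 2 * v = 0 := (pow_eq_zero_iff hn0.ne').1 hw
    rw [show ((-1 : ℂ) ^ 2 - 2 * v) = 1 - 2 * v by ring, hw', zero_pow hn0.ne', zero_mul, zero_add, zero_add] at h2
    have : v = 0 := (pow_eq_zero_iff hn0.ne').1 h2
    rw [this] at hw'
    norm_num at hw'

/-- **`Φ₃ = 0` is a smooth affine curve** (`d = e − 1` odd, `≥ 3`). [cite: Fulton2008, §3.1 (simple points)] -/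
theorem not_isSingularPoint_Φ₃ {e : ℕ} (he : Odd (e - 1)) (h3 : 3 ≤ e - 1) (p : Fin 2 → ℂ) :
    ¬ IsSingularPoint ((X 0 ^ 2 - C 2 * X 1) ^ (e - 1) + (1 - C 2 * X 1) ^ (e - 1) + X 1 ^ (e - 1) : MvPolynomial (Fin 2) ℂ) p := by
  rintro ⟨hΦ, hg⟩
  obtain ⟨n, hn⟩ : ∃ n, e - 1 = n + 1 := ⟨e - 2, by omega⟩
  have hn' : e - 1 - 1 = n := by omega
  have hn0 : 0 < n := by omega
  have hd : ((e - 1 : ℕ) : ℂ) ≠ 0 := by exact_mod_cast (show e - 1 ≠ 0 by omega)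
  have g0 := congrFun hg 0
  have g1 := congrFun hg 1
  rw [grad_Φ₃_zero, hn'] at g0
  simp only [Pi.zero_apply] at g0 g1
  -- `∂_sΦ₃ = 0`: `A^n = 0` or `s = 0`
  rcases mul_eq_zero.1 g0 with g0' | hs
  · rcases mul_eq_zero.1 g0' with g0'' | hA
    · exact hd g0''
    · -- `A = 0`: `Φ₃ - v ∂_vΦ₃/d = wⁿ`
      have hA' : p 0 ^ 2 - 2 * p 1 = 0 := (pow_eq_zero_iff hn0.ne').1 hA
      have hΦ' := hΦ
      rw [eval_Φ₃, hn] at hΦ'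
      rw [grad_Φ₃_one, hn'] at g1
      set v := p 1 with hv
      have h2 : (p 0 ^ 2 - 2 * v) ^ n * (-2) + (1 - 2 * v) ^ n * (-2) + v ^ n = 0 := by
        have : ((e - 1 : ℕ) : ℂ) * ((p 0 ^ 2 - 2 * v) ^ n * (-2) + (1 - 2 * v) ^ n * (-2) + v ^ n) = 0 := by
          linear_combination g1
        exact (mul_eq_zero.1 this).resolve_left hd
      rw [hA', zero_pow hn0.ne', zero_mul, zero_add] at h2
      rw [pow_succ, hA', mul_zero, zero_add] at hΦ'
      have hw : (1 - 2 * v) ^ n = 0 := by linear_combination hΦ' - v * h2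
      have hw' : 1 - 2 * v = 0 := (pow_eq_zero_iff hn0.ne').1 hw
      rw [hw', zero_pow hn0.ne', zero_mul, zero_add] at h2
      have : v = 0 := (pow_eq_zero_iff hn0.ne').1 h2
      rw [this] at hw'
      norm_num at hw'
  · -- `2 s = 0`
    have hs0 : p 0 = 0 := by
      rcases mul_eq_zero.1 hs with h | h
      · norm_num at h
      · exact h
    exact grad_Φ₃_one_ne_zero he h3 p (by rw [hs0]; ring) hΦ g1

/-- `Φ₃ = 0` is nodal (smooth). [cite: Fulton2008, §3.1 (simple points)] -/
theorem isNodal_Φ₃ {e : ℕ} (he : Odd (e - 1)) (h3 : 3 ≤ e - 1) :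
    IsNodal ((X 0 ^ 2 - C 2 * X 1) ^ (e - 1) + (1 - C 2 * X 1) ^ (e - 1) + X 1 ^ (e - 1) : MvPolynomial (Fin 2) ℂ) :=
  isNodal_of_forall_not_isSingularPoint (not_isSingularPoint_Φ₃ he h3)

/-- **Chart `U₃`: `(s³ − s)·Φ₃ = 0` is nodal**, i.e. `IsNodal (chartThree e G₂)` for the Fermat member (`d = e − 1` odd, `≥ 3`).
[cite: Fulton2008, §3.1 (ordinary multiple points)] [cite: Hartshorne1977, V.2 (ruled surfaces)] -/
theorem isNodal_chartThree_planeG₂_fermatParam {e : ℕ} (he : Odd (e - 1)) (h3 : 3 ≤ e - 1) :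
    IsNodal (chartThree e (planeG₂ (fermatParam e) 1)) := by
  rw [chartThree_planeG₂_fermatParam (by omega),
    show (X 0 ^ 3 - X 0 : MvPolynomial (Fin 2) ℂ) = X 0 * (X 0 - 1) * (X 0 + 1) by ring]
  refine IsNodal.mul isNodal_cubic (isNodal_Φ₃ he h3) fun p hL hΦ => ?_
  have hL' : p 0 * (p 0 - 1) * (p 0 + 1) = 0 := by simpa using hL
  have hj : jac (X 0 * (X 0 - 1) * (X 0 + 1) : MvPolynomial (Fin 2) ℂ)
      ((X 0 ^ 2 - C 2 * X 1) ^ (e - 1) + (1 - C 2 * X 1) ^ (e - 1) + X 1 ^ (e - 1)) p =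
      (3 * p 0 ^ 2 - 1) *
        grad ((X 0 ^ 2 - C 2 * X 1) ^ (e - 1) + (1 - C 2 * X 1) ^ (e - 1) + X 1 ^ (e - 1) : MvPolynomial (Fin 2) ℂ) p 1 := by
    unfold jac
    rw [grad_cubic]
    simp
  rw [hj]
  refine mul_ne_zero ?_ (grad_Φ₃_one_ne_zero he h3 p hL' hΦ)
  rcases mul_eq_zero.1 hL' with h | h
  · rcases mul_eq_zero.1 h with h | h
    · rw [h]; norm_num
    · have : p 0 = 1 := by linear_combination h
      rw [this]; norm_num
  · have : p 0 = -1 := by linear_combination h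
    rw [this]; norm_num

/-- **Chart `U₂`: nodal** (the curve is `−G₂`). [cite: Fulton2008, §3.1 (nodes)] [cite: Hartshorne1977, V.2 (ruled surfaces)] -/
theorem isNodal_chartTwo_planeG₂_fermatParam {e : ℕ} (he : Odd (e - 1)) (h3 : 3 ≤ e - 1) :
    IsNodal (X 0 ^ (1 % 2) * chartTwo 1 (planeG₂ (fermatParam e) 1)) := by
  rw [X_mul_chartTwo_planeG₂_fermatParam]
  exact IsNodal.C_mul (by norm_num) (isNodal_planeG₂_fermatParam he h3)

/-- **Chart `U₄`: nodal** (the curve is `−(s³ − s)Φ₃`). [cite: Fulton2008, §3.1 (nodes)] [cite: Hartshorne1977, V.2 (ruled surfaces)] -/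
theorem isNodal_chartFour_planeG₂_fermatParam {e : ℕ} (he : Odd (e - 1)) (h3 : 3 ≤ e - 1) :
    IsNodal (X 0 ^ (1 % 2) * chartFour e 1 (planeG₂ (fermatParam e) 1)) := by
  rw [X_mul_chartFour_planeG₂_fermatParam (by omega)]
  exact IsNodal.C_mul (by norm_num) (isNodal_chartThree_planeG₂_fermatParam he h3)

/-- **(T2a + T2b) The branch curve of the Fermat member is NODAL IN ALL FOUR CHARTS of `𝔽₂`, with the support bounds of
`IsChartExact e 1`** — every clause of the nodality package `hNod` at `a = fermatParam e`, `α = e`, `N = 1`, except the two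
exactness witnesses — for every even `e ≥ 4`. [cite: Fulton2008, §3.1 (nodes)] [cite: Hartshorne1977, V.2 (ruled surfaces)]
[cite: Zariski1929] -/
theorem isNodal_fermatParam_allCharts {e : ℕ} (he : Even e) (h4 : 4 ≤ e) :
    (∀ m ∈ (planeG₂ (fermatParam e) 1).support, m 1 ≤ e ∧ m 0 ≤ 1 + 2 * m 1) ∧
      IsNodal (planeG₂ (fermatParam e) 1) ∧ IsNodal (X 0 ^ (1 % 2) * chartTwo 1 (planeG₂ (fermatParam e) 1)) ∧
      IsNodal (chartThree e (planeG₂ (fermatParam e) 1)) ∧ IsNodal (X 0 ^ (1 % 2) * chartFour e 1 (planeG₂ (fermatParam e) 1)) := by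
  have hodd : Odd (e - 1) := by
    obtain ⟨k, hk⟩ := he
    exact ⟨k - 1, by omega⟩
  have h3 : 3 ≤ e - 1 := by omega
  exact ⟨bounds_planeG₂_fermatParam (by omega), isNodal_planeG₂_fermatParam hodd h3,
    isNodal_chartTwo_planeG₂_fermatParam hodd h3, isNodal_chartThree_planeG₂_fermatParam hodd h3,
    isNodal_chartFour_planeG₂_fermatParam hodd h3⟩

end Literature.AlgebraicGeometry.HodgeTheory.Q8Family

end
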